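import Summits.Schanuel.Schanuel.Theorems.RootDecomp1BQuadFrame05
import Summits.Schanuel.Schanuel.Theorems.RootDecomp1EPointTransfer04

/-!
# RootDecomp1BAlgFrame — lens 4, generation 40 «UNBOUNDED-DEGREE FRAMES» (lane B-R24 (b′), PRICE B-β, RULE B-R26): X(2) and the three At-cells at (1 | ρ) for every ρ in the class `AlgUltraLiouville` (doubly-exponential hyper-approximation by real algebraic irrationals of UNBOUNDED degree) modulo `Roy2014_thm_1_1` ONLY — the degree a running parameter of Roy's point-explicit L–W measure (budget lemma `algFrameMeasure_explicit_of_roy` with the floor exp(−royC D·exp(A^8)·(1+log H)) in its TYPE); the NAMED MEMBER ρ_A (a tower over 2^{1/p}, prime degrees p → ∞) with HYPOTHESIS-FREE membership, degree certificate [ℚ(β_K):ℚ] = g_K, position certificate |ρ_A − γ| ≥ exp(−A⁴) and the exclusions BY TREE NAMES (¬Hyper, ¬QuadHyper, ¬Ultra ×2, ¬LiouvilleOrder 8, transcendental) — part 1 (RootDecomp1BAlgFrame01): §D class + measure shape; §R helpers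

(lens-4 g40 HOME kernel AlgFrame.lean fe3f4606…, 1974 l, imports tree RootDecomp1BQuadFrame05 + RootDecomp1EPointTransfer04 only; CLAIM L2078, RULING + CHECKLIST B-g40 L2080, NODE L2101 / REQUEST L2102 / RESULT L2103, critic VERDICT L2111 (crit g9: (A) CLEARED — ONE CELL (B-β); lens-4 tally THEOREM ×6 + CELL ×3; RULE B-R26 in force (the Roy-transfer line on 1B CLOSED); PORT GO 01–09 `--supports stmt-Schanuel-24622`); port by census-1 gen 18 as `RootDecomp1BAlgFrame01`–`09` along K's sections: 01 = §D the class `AlgUltraLiouville` + the measure shape `AlgFrameMeasure` + §R helpers (`royC`); 02 = §R the budget lemma `algFrameMeasure_explicit_of_roy` (Roy ⟹ the algebraic frame measure in EVERY degree; scoped `maxHeartbeats 1600000` carried as in K); 03 = §E the engine `algebraicIndependent_exp_frame_of_algUltraLiouville (hRoy)` + the `![…]` forms; 04 = §M.1–§M.3 prime degrees `gdeg`, radicals `theta`, frame data `Nseq`/`Pseq`/`fd` (with `attribute [irreducible] fd`), `betaSeq`, `fSeq`, `ASeq`, growth; 05 = §M.4–§M.5 increments, the limit `rhoA`, MEMBERSHIP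 `algUltraLiouville_rhoA`; 06 = §M.6–§M.7 degree certificate `finrank_adjoin_theta` / `adjoin_betaSeq_eq` + the number-field Liouville inequality (`FK`, `thetaF`, `sigma0`, norm to ℚ); 07 = §M.8–§M.9 the frame bound, the tower inequality, scale selection, `cert_arith`; 08 = §M.10–§M.11 THE POSITION CERTIFICATE `rhoA_far_from_degree_le` + EXCLUSIONS by tree names (`not_hyperLiouville_rhoA`, `not_quadHyperLiouville_rhoA`, `not_ultraLiouville_rhoA` / `'`, `not_liouvilleOrder_rhoA`, `transcendental_rhoA`); 09 = §C the cells `four_le_polarDeg_one_of_algUltra (hRoy)` (+ swap), the At-cells, the member cells at ρ_A, `rhoA_position`.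
PORT EDITS: the three `set_option linter.*` lines dropped and the one surfaced `unnecessarySimpa` fixed (`simpa using h12` ↦ `simp`, §R); 74 one-line docstrings added; two generic helpers made `private` (`three_mul_le_two_pow`, `half_identity`) with per-part private copies of those and of K's own private helpers; statements and proofs verbatim. `--supports stmt-Schanuel-24622`; no census credit carried; rung 0 — nothing here proves Schanuel.)
-/

/-!
# RootDecomp1BAlgFrame — lens 4, generation 40 «UNBOUNDED-DEGREE FRAMES» (RULE B-R24 (b′), CHECKLIST B-g40)

**STATUS: PROVED modulo the ONE tree fact `Roy2014_thm_1_1` (Roy 2013, Thm 1.1; already a cited `def : Prop` of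
`RootDecomp1EPointTransfer01`; NO new `def : Prop`).  0 `sorry`; standard axioms.  K file (kernel).**

## What is proved

* §D/§R/§E — THE ENGINE mod Roy ONLY.  For every real `ρ` in the NEW class
  `AlgUltraLiouville ρ :≡ ∀ m, ∃ β f A, m ≤ A ∧ β ∉ ℚ ∧ f ≠ 0 ∧ deg f ≤ A ∧ |coeff f| ≤ A ∧ f(β) = 0 ∧
  |ρ − β| < exp(−exp(A^m))` (hyper-approximable at a DOUBLY-exponential rate by real algebraic irrationals of
  UNBOUNDED degree), `algebraicIndependent_exp_frame_of_algUltraLiouville : Roy2014_thm_1_1 → AlgUltraLiouville ρ →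
  AlgebraicIndependent ℚ ![e, e^ρ, e^i, e^{ρ i}]`.  The BUDGET is the lemma `algFrameMeasure_explicit_of_roy` whose TYPE
  carries Roy's floor `exp(−royC D · exp(A^8) · (1 + log H))`, `royC D = 6 s₁⁴ + exp((36 s₁⁵)⁸)`, `s₁ = royS 4 2 (D+1)`:
  the DEGREE `≤ A` of the approximant sits in Roy's exponent `18 S⁴`, `S = 576 d (D+1)`, `d = [ℚ(β,i):ℚ] ≤ 2A` — whence a
  degree-free but doubly-exponential floor, beaten by the class rate `exp(−exp(A^m))` at the level `m = N + 1 + m₁`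
  (`m₁ > C(1 + log H) + Kl + δ₁⁻¹ + 3`); the Lipschitz side is the tree's `exists_lipschitz_Ff`, the relation the tree's
  `exists_int_relation`.
* §C — THE CELLS mod Roy ONLY: X(2) `((2+2 : ℕ) : Cardinal) ≤ polarDeg ![1, ρ]` (`four_le_polarDeg_one_of_algUltra`,
  `_swap_`, and VERBATIM in the `KleinPolarSchanuel`-body shape), and the At-cells of items 32406 / 32407 / 32408 at
  `(1 | ρ)` with their binders verbatim (`sharpRelativeLindemannAt_one_algUltra`, `tameDefectZeroAt_one_algUltra`,
  `wildSharpDefectZeroAt_one_algUltra`, `wildSharpDefectZeroInitAt_one_algUltra`); the same at the named member.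
* §M — THE MEMBER, hypothesis-free: `rhoA = lim β_K`, `β_K = (P_K + 2^{1/g_K})/2^{N_K}` (`g_K` prime, `K+3 < g_K ≤ 2K+6`;
  `P_{K+1} = ⌊2^{N_{K+1}} β_K⌋`, `N_{K+1} = 2·3^{A_K^{K+1}} + 2`, `A_K` = the naive size of the frame `f_K =
  (2^{N_K} X − P_K)^{g_K} − 2`): `algUltraLiouville_rhoA : AlgUltraLiouville rhoA`; the DEGREE CERTIFICATE
  `finrank_adjoin_theta : [ℚ(2^{1/g_K}):ℚ] = g_K` (`adjoin_betaSeq_eq : ℚ(β_K) = ℚ(2^{1/g_K})`); the Liouville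
  inequality at `β_K` by the norm `N_{ℚ(2^{1/g_K})/ℚ}` (`liouville_betaSeq`); and the POSITION CERTIFICATE
  `rhoA_far_from_degree_le d : ∃ A₀, ∀ γ h A, A₀ ≤ A → h ≠ 0 → deg h ≤ d → |coeff h| ≤ A → h(γ) = 0 →
  exp(−A⁴) ≤ |rhoA − γ|` — whence, BY TREE NAMES, `¬ HyperLiouville rhoA` (1K `HyperCell`), `¬ QuadHyperLiouville rhoA`
  (g36), `¬ UltraLiouville rhoA` (BOTH tree copies, `Iff.rfl`-equal), `¬ LiouvilleOrder k rhoA` (`k ≥ 4`, in particular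
  `8`), `Transcendental ℚ rhoA`, and `∀ d, ¬ DegHyperLiouville d rhoA` (the bounded-degree nest, with the proved links
  `HyperLiouville → DegHyperLiouville 1`, `QuadHyperLiouville → DegHyperLiouville 2`).  Summary: `rhoA_position`.

## Honest labels (CLAIM L2078 / RULING L2080)

(b′) not (b): `rhoA` is certified OUTSIDE EVERY BOUNDED-DEGREE hyper class — it is NOT certified of finite type (its
`w_d` are not bounded here; `rhoA` may well be Liouville in Mathlib's sense, and nothing is claimed about `¬ Liouville`).
`t(1, ρ) = 5` is NOT claimed in general degree (the norm-form clearing of g36 is degree 2 only); the ∀-items 32406–08,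
`KleinPolarSchanuel` and the summit are NOT derived (controls C5–C7 of the C file); after g40 the Roy-transfer line on
1B is CLOSED (RULE B-R26) — the finite-type core `(1|ρ)` (e.g. `ρ = e`: `e^e`) is an open barrier, see NODE.md.
-/

noncomputable section

open Complex IntermediateField MvPolynomial

namespace Summit.Schanuel.Schanuel.Theorems.RootDecomp1BAlgFrame

open Summit.Schanuel.Schanuel.Theorems.RootDecomp1EPointTransfer (Roy2014_thm_1_1)
open Summit.Schanuel.Schanuel.Theorems.RootDecomp1KHyper (mvlen mvlen_nonneg abs_coeff_le_mvlen one_le_mvlen)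
open Summit.Schanuel.Schanuel.Theorems.RootDecomp1BHyperFrame (royDeg royS RoyNF roy_tree_iff framePt Ff
  Ff_eq_aeval exists_lipschitz_Ff linearIndependent_one_irrational)
open Summit.Schanuel.Schanuel.Theorems.RootDecomp1BQuadFrame (qy qe qpt qpt_apply framePt_qy_qe linearIndependent_qpt
  QuadHyperLiouville)
open Summit.Schanuel.Schanuel.Theorems.RootDecomp1BFedFlagCore (KleinIH polarDeg polarField)
open Summit.Schanuel.Schanuel.Theorems.RootDecomp1BDefectFloorDefs (SharpRelativeLindemannAt TameDefectZeroAt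
  WildSharpDefectZeroAt WildSharpDefectZeroInitAt WildSharpInitAt)
open Summit.Schanuel.Schanuel.Theorems.RootDecomp1BDefectFloorCells (natCast_le_trdeg_of_algebraicIndependent)
open Summit.Schanuel.Schanuel.Theorems.RootDecomp1BRadicalDescent (exists_int_relation)
open Summit.Schanuel.Schanuel.Theorems.RootDecomp1BMovingZero (mem_polarField_one mem_polarField_swap)

/-! ## §D  The class and the measure shape -/

section Defs

/-- **THE CLASS `AlgUltraLiouville`**: for every `m` there is a REAL ALGEBRAIC IRRATIONAL `β`, root of a non-zero
`f ∈ ℤ[X]` whose DEGREE and naive height are bounded only by the level datum `A ≥ m`, with `|ρ − β| < exp(−exp(A^m))`.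
The degree of the approximant is NOT bounded along the sequence (this is the point); the doubly-exponential rate is the
exact price of the degree in Roy's measure (exponent `18 S⁴`, `S` linear in `[ℚ(β, i):ℚ]`). -/
def AlgUltraLiouville (ρ : ℝ) : Prop :=
  ∀ m : ℕ, ∃ (β : ℝ) (f : Polynomial ℤ) (A : ℕ), m ≤ A ∧ Irrational β ∧ f ≠ 0 ∧ f.natDegree ≤ A ∧
    (∀ i, |f.coeff i| ≤ (A : ℤ)) ∧ Polynomial.aeval β f = 0 ∧
    |ρ - β| < Real.exp (-Real.exp ((A : ℝ) ^ m))

/-- **ALGEBRAIC FRAME MEASURE** (all degrees at once): for every `D` there are `C ≥ 0`, `N` with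
`|P(e, e^β, e^i, e^{iβ})| ≥ exp(−C · exp(A^N) · (1 + log H))` for every real algebraic irrational `β`, root of a non-zero
`f ∈ ℤ[X]` of degree `≤ A` and height `≤ A`, and every non-zero `P ∈ ℤ[X₁..X₄]` of degree `≤ D`, height `≤ H`. -/
def AlgFrameMeasure : Prop :=
  ∀ D : ℕ, ∃ (C : ℝ) (N : ℕ), 0 ≤ C ∧
    ∀ (β : ℝ) (f : Polynomial ℤ) (A : ℕ), Irrational β → f ≠ 0 → f.natDegree ≤ A →
      (∀ i, |f.coeff i| ≤ (A : ℤ)) → Polynomial.aeval β f = 0 →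
    ∀ P : MvPolynomial (Fin 4) ℤ, P ≠ 0 → P.totalDegree ≤ D →
    ∀ H : ℕ, 1 ≤ H → (∀ s, |P.coeff s| ≤ (H : ℤ)) →
      Real.exp (-(C * Real.exp ((A : ℝ) ^ N) * (1 + Real.log H))) ≤
        ‖MvPolynomial.aeval (fun j => cexp (qpt β j)) P‖

/-- **THE FIXED-DEGREE CLASS `DegHyperLiouville d`** (the bounded-degree nest of RULE B-R24, one `d` at a time):
single-exponential hyper-approximation by real algebraic numbers of degree `≤ d`. -/
def DegHyperLiouville (d : ℕ) (ρ : ℝ) : Prop :=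
  ∀ m : ℕ, ∃ (γ : ℝ) (h : Polynomial ℤ) (A : ℕ), m ≤ A ∧ h ≠ 0 ∧ h.natDegree ≤ d ∧
    (∀ i, |h.coeff i| ≤ (A : ℤ)) ∧ Polynomial.aeval γ h = 0 ∧ γ ≠ ρ ∧
    |ρ - γ| < Real.exp (-((A : ℝ) ^ m))

end Defs

/-! ## §R  Roy ⟹ the algebraic frame measure (the number field `ℚ(β, i)` varies in EVERY degree) -/

section RoyAdapter

open Polynomial in
/-- `aeval` of an integer polynomial does not change under `map ℤ → ℚ`. -/
theorem aeval_map_int {B : Type*} [CommRing B] [Algebra ℚ B] (z : B) (f : ℤ[X]) :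
    Polynomial.aeval z (f.map (Int.castRingHom ℚ)) = Polynomial.aeval z f := by
  rw [Polynomial.aeval_def, Polynomial.aeval_def, Polynomial.eval₂_map]
  congr 1
  exact RingHom.ext_int _ _

open Polynomial in
/-- `aeval` of an integer polynomial commutes with `ℝ → ℂ`. -/
theorem aeval_ofReal_int (x : ℝ) (f : ℤ[X]) :
    Polynomial.aeval (x : ℂ) f = ((Polynomial.aeval x f : ℝ) : ℂ) := by
  have h := Polynomial.hom_eval₂ f (algebraMap ℤ ℝ) Complex.ofRealHom x
  have hc : Complex.ofRealHom.comp (algebraMap ℤ ℝ) = algebraMap ℤ ℂ := RingHom.ext_int _ _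
  rw [hc] at h
  rw [Polynomial.aeval_def, Polynomial.aeval_def]
  exact h.symm

open Polynomial in
/-- A root `z ∈ ℂ` of a non-zero `f ∈ ℤ[X]` is integral over `ℚ` with `[ℚ(z):ℚ] ≤ deg f`. -/
theorem finrank_adjoin_root_le {f : ℤ[X]} (hf : f ≠ 0) {z : ℂ} (hz : aeval z f = 0) :
    IsIntegral ℚ z ∧ Module.finrank ℚ ℚ⟮z⟯ ≤ f.natDegree := by
  set p : ℚ[X] := f.map (Int.castRingHom ℚ) with hp
  have hp0 : p ≠ 0 := (Polynomial.map_ne_zero_iff (Int.castRingHom ℚ).injective_int).mpr hf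
  have hpz : aeval z p = 0 := by rw [hp, aeval_map_int, hz]
  have halg : IsAlgebraic ℚ z := ⟨p, hp0, hpz⟩
  have hint : IsIntegral ℚ z := halg.isIntegral
  refine ⟨hint, ?_⟩
  rw [IntermediateField.adjoin.finrank hint]
  have h1 := minpoly.degree_le_of_ne_zero ℚ z hp0 hpz
  have h2 : p.natDegree ≤ f.natDegree := Polynomial.natDegree_map_le
  exact (Polynomial.natDegree_le_natDegree h1).trans h2

open Polynomial in
/-- HOUSE BOUND (Cauchy): every root `z` of a non-zero `f ∈ ℤ[X]` with coefficients `≤ A` in absolute value has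
`‖z‖ ≤ A + 1`. -/
theorem norm_root_le {f : ℤ[X]} (hf : f ≠ 0) {A : ℕ} (hA : ∀ i, |f.coeff i| ≤ (A : ℤ)) {z : ℂ}
    (hz : aeval z f = 0) : ‖z‖ ≤ A + 1 := by
  set p : ℂ[X] := f.map (Int.castRingHom ℂ) with hp
  have hp0 : p ≠ 0 := (Polynomial.map_ne_zero_iff (Int.castRingHom ℂ).injective_int).mpr hf
  have hroot : p.IsRoot z := by
    rw [IsRoot.def, hp, Polynomial.eval_map, ← algebraMap_int_eq, ← Polynomial.aeval_def, hz]
  have hlt := IsRoot.norm_lt_cauchyBound hp0 hroot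
  -- `cauchyBound p ≤ A + 1`
  have hlead : (1 : NNReal) ≤ ‖p.leadingCoeff‖₊ := by
    have hl : p.leadingCoeff = ((f.leadingCoeff : ℤ) : ℂ) := by
      rw [hp, leadingCoeff_map_of_injective (Int.castRingHom ℂ).injective_int]; rfl
    have hne : f.leadingCoeff ≠ 0 := leadingCoeff_ne_zero.mpr hf
    have h1 : (1 : ℝ) ≤ ‖p.leadingCoeff‖ := by
      rw [hl, Complex.norm_intCast]; exact_mod_cast Int.one_le_abs hne
    exact_mod_cast h1
  have hsup : (Finset.range p.natDegree).sup (fun i => ‖p.coeff i‖₊) ≤ (A : NNReal) := by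
    refine Finset.sup_le fun i _ => ?_
    have h1 : ‖p.coeff i‖ ≤ A := by
      rw [hp, Polynomial.coeff_map]
      simp only [eq_intCast, Complex.norm_intCast]
      exact_mod_cast hA i
    exact_mod_cast h1
  have hcb : cauchyBound p ≤ (A : NNReal) + 1 := by
    unfold cauchyBound
    gcongr
    calc (Finset.range p.natDegree).sup (fun i => ‖p.coeff i‖₊) / ‖p.leadingCoeff‖₊
        ≤ (Finset.range p.natDegree).sup (fun i => ‖p.coeff i‖₊) / 1 := by gcongr
      _ ≤ (A : NNReal) := by rw [div_one]; exact hsup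
  have h : (‖z‖₊ : ℝ) ≤ ((A : NNReal) + 1 : NNReal) := by exact_mod_cast (hlt.le.trans hcb)
  simpa using h

/-- An integer is an algebraic integer in `ℂ`. -/
private theorem isIntegral_intCast_AF (z : ℤ) : IsIntegral ℤ (z : ℂ) := by
  simpa using (isIntegral_algebraMap (R := ℤ) (A := ℂ) (x := z))

/-- `i` is an algebraic integer. -/
private theorem isIntegral_I_AF : IsIntegral ℤ I := by
  refine ⟨Polynomial.X ^ 2 + Polynomial.C 1, Polynomial.monic_X_pow_add_C 1 two_ne_zero, ?_⟩
  simp [Polynomial.eval₂_add, Polynomial.eval₂_X_pow, Complex.I_sq]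

open Polynomial in
/-- DENOMINATOR: `|lead f| · z` is an algebraic integer for a root `z` of `f ∈ ℤ[X]`. -/
theorem isIntegral_natAbs_lead_mul {f : ℤ[X]} {z : ℂ} (hz : aeval z f = 0) :
    IsIntegral ℤ (((f.leadingCoeff.natAbs : ℕ) : ℂ) * z) := by
  have h := isIntegral_leadingCoeff_smul (R := ℤ) (p := f) (x := z) hz
  rw [zsmul_eq_mul] at h
  rcases Int.natAbs_eq f.leadingCoeff with h1 | h1
  · have : ((f.leadingCoeff.natAbs : ℕ) : ℂ) = (f.leadingCoeff : ℂ) := by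
      conv_rhs => rw [h1]
      simp
    rw [this]; exact h
  · have : ((f.leadingCoeff.natAbs : ℕ) : ℂ) = -(f.leadingCoeff : ℂ) := by
      conv_rhs => rw [h1]
      simp
    rw [this, neg_mul]; exact h.neg

/-- `x ≤ exp x`. -/
private theorem le_exp_self (x : ℝ) : x ≤ Real.exp x := by linarith [Real.add_one_le_exp x]

/-- **ROY'S FLOOR CONSTANT IN DEGREE `D`** (explicit, `D`-only): `C_D = 6 s₁⁴ + exp((36 s₁⁵)⁸)`, `s₁ = royS 4 2 (D+1)`
(= `576·2·(D+2)·…`, the tree's `royS`).  This is the BUDGET the class rate `exp(−exp(A^m))` has to beat: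
`exp(−C_D · exp(A^8) · (1 + log H))` — doubly exponential in the level `A` because the DEGREE `≤ A` of the approximant
sits in Roy's exponent `18 S⁴`. -/
def royC (D : ℕ) : ℝ :=
  6 * ((royS 4 2 (D + 1) : ℕ) : ℝ) ^ 4 + Real.exp ((36 * ((royS 4 2 (D + 1) : ℕ) : ℝ) ^ 5) ^ 8)

/-- `0 ≤ royC D`. -/
theorem royC_nonneg (D : ℕ) : 0 ≤ royC D := by unfold royC; positivity

end RoyAdapter

end Summit.Schanuel.Schanuel.Theorems.RootDecomp1BAlgFrame

end
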